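import Summits.RiemannHypothesis.RiemannHypothesis.Theorems.MotivicDoorFfFibreLattice
import Summits.RiemannHypothesis.RiemannHypothesis.Theorems.MotivicDoorFfLatticeFloor

/-!
# Motivic door, function-field side (C)(i), part 7a: SPARSE LAG SETS — the sparse fibre walk
(pub-rhdoor seat ff-1.  HONEST FRAMING: lottery ticket at the motivic door; RH probability negligible; consolation
prizes are real: a new semi-local Weil-positivity theorem, or a located gap in the Connes–Consani programme, plus the
ff-door theorem.  No claim about `ζ`; "RH(q,h)" is `|α| = √q` for the complex roots of ONE integer polynomial `h`.)

Parts 2–6 settled door (i) for WINDOW readers (prefixes `T_0, …, T_M`: blind below the handover `M < g`, deciding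
from `M ≥ g` by pinning, resp. `M ≥ 2g - 1` by positivity) and for STRIDE readers (part 6: the `2g` corner entries
`K(0), K(N), …, K((2g-1)N)` decide, for every stride `N`).  The item left open there ((i).G of `FF-DOOR.md`, "sparse
lag sets") asks which SETS OF LAGS `F ⊆ ℕ` can support a reader deciding RH at dimension `g` at all; parts 7a–7c
answer it below the handover exactly and above it by a divisibility condition.  A reader `Φ : Tower → Prop` is
`F`-TRACE-LOCAL if it only depends on the corner entries `T_n(0,n) = K(n) = s_n / (2 (√q)^n)`, `n ∈ F` — equivalently
(`corner_eq_iff_powerSum_eq`) on the power sums `s_n`, i.e. on the point counts `N_n = q^n + 1 - s_n`, `n ∈ F`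
(dictionary and FE as in Goppa, Geometry and Codes (1988), p. 70).  Honest data (monic, degree `2g`, coefficient FE)
are typed INLINE as in parts 2–6.  PROVED here, all [folklore] algebra:

* §1 corners = power sums (`corner_eq_iff_powerSum_eq`, `corner_zero_eq_of_natDegree_eq`); the RH-true datum
  `x^{2g} + q^g` (`ffRH_X_pow_add_C`).
* §2 NEWTON'S IDENTITY, top-indexed, over `ℤ` (`powerSum_frobRoots_newton`, `int_powerSum_newton`; the integrality
  of the `s_n` is ffcal's `MotivicDoorFfLatticeFloor.exists_int_powerSum_frobRoots`).
* §3 THE SPARSE FIBRE WALK (`sparseFibre_walk`, `exists_honest_offLag`): for an honest `h` of dimension `g`, a lag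
  `1 ≤ m ≤ g` and ANY `t ∈ ℤ` there is an honest datum of dimension `g` with the SAME `s_j` for all
  `j ∈ [1,g] ∖ {m}`, with `c_{2g-m}` moved by `(g!)^g t` and `s_m` moved by `-m (g!)^g t`: move the free
  coefficient `c_{2g-m}` by a multiple of `(g!)^g` (one move of part 5b's FE-symmetric fibre shift,
  `honest_shift_single`) and restore `s_{m+1}, …, s_g` one lag at a time through the integer Newton recursion, the
  factorials clearing its denominators `n ≤ g`.  Hence the SPARSE FIBRE `{f honest : s_j(f) = s_j(h), j ∈ [1,g] ∖ {m}}`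
  is INFINITE through every honest datum (`sparseFibre_infinite`), its RH-true part FINITE (Weil box,
  `sparseFibre_ffRH_finite`), its RH-false part INFINITE (`sparseFibre_fakes_infinite`): no `g - 1` of the first `g`
  point counts of an honest datum determine the remaining one — not even up to finitely many values, at any `q`.

Parts 7b (`MotivicDoorFfSparseThreshold`: the exact threshold below the handover) and 7c (`MotivicDoorFfResidueLags`:
residue classes above it) draw the door reading.  Nothing here is, or implies, a statement about `ζ`.
-/

set_option linter.dupNamespace false

noncomputable section

open Polynomial Finset

open Summit.RiemannHypothesis.RiemannHypothesis.Theorems.PfPersistence.FfAngleTwin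
open Summit.RiemannHypothesis.RiemannHypothesis.Theorems.MotivicDoor.FfLatticeFloor

namespace Summit.RiemannHypothesis.RiemannHypothesis.Theorems.MotivicDoor.FunctionField

/-! ## 1. Trace readers: the corner entries of the tower are the power sums -/

/-- The corner entry `T_n(0,n) = K(n) = s_n / (2 (√q)^n)` of the tower of a datum determines and is determined by
the power sum `s_n` (`q > 0`). [folklore] -/
theorem corner_eq_iff_powerSum_eq {q : ℝ} (hq : 0 < q) (h h' : ℤ[X]) (n : ℕ) :
    weilWindowTower q h n 0 (Fin.last n) = weilWindowTower q h' n 0 (Fin.last n) ↔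
      powerSum (frobRoots h) n = powerSum (frobRoots h') n := by
  rw [weilWindowTower_corner, weilWindowTower_corner, ffKernel_eq, ffKernel_eq]
  have h2 : (2 * (Real.sqrt q : ℂ) ^ n) ≠ 0 :=
    mul_ne_zero two_ne_zero (pow_ne_zero _ (by exact_mod_cast (Real.sqrt_pos.2 hq).ne'))
  rw [div_left_inj' h2]

/-- The lag-`0` corner `K(0) = deg / 2` is the same for all monic data of the same degree. [folklore] -/
theorem corner_zero_eq_of_natDegree_eq (q : ℝ) {h h' : ℤ[X]} (hh : h.Monic) (hh' : h'.Monic)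
    (hdeg : h.natDegree = h'.natDegree) :
    weilWindowTower q h 0 0 (Fin.last 0) = weilWindowTower q h' 0 0 (Fin.last 0) := by
  rw [weilWindowTower_corner, weilWindowTower_corner, ffKernel_zero, ffKernel_zero, card_frobRoots hh,
    card_frobRoots hh', hdeg]

/-- The datum `x^{2g} + q^g` is RH-TRUE: its roots `α` have `α^{2g} = -q^g`, so `|α| = √q`. [folklore] -/
theorem ffRH_X_pow_add_C (q : ℕ) {g : ℕ} (hg : 1 ≤ g) :
    ∀ α ∈ frobRoots (X ^ (2 * g) + C ((q : ℤ) ^ g) : ℤ[X]), ‖α‖ = Real.sqrt q := by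
  intro α hα
  have hne : (X ^ (2 * g) + C ((q : ℂ) ^ g) : ℂ[X]) ≠ 0 :=
    (monic_X_pow_add_C _ (by omega)).ne_zero
  have hmap : (X ^ (2 * g) + C ((q : ℤ) ^ g) : ℤ[X]).map (Int.castRingHom ℂ) = X ^ (2 * g) + C ((q : ℂ) ^ g) := by
    simp [Polynomial.map_add, Polynomial.map_pow]
  rw [frobRoots, hmap, mem_roots hne, IsRoot.def, eval_add, eval_pow, eval_X, eval_C] at hα
  have hpow : α ^ (2 * g) = -((q : ℂ) ^ g) := eq_neg_of_add_eq_zero_left hα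
  have hnorm : (‖α‖ ^ 2) ^ g = ((q : ℝ)) ^ g := by
    rw [← pow_mul, ← norm_pow, hpow, norm_neg, norm_pow]; simp
  have hsq : ‖α‖ ^ 2 = (q : ℝ) := (pow_left_inj₀ (sq_nonneg _) (Nat.cast_nonneg q) (by omega)).1 hnorm
  rw [← Real.sqrt_sq (norm_nonneg α), hsq]


/-! ## 2. Newton's identity, top-indexed, and the integrality of the power sums -/

/-- NEWTON'S IDENTITY for the roots of a monic integer polynomial `h` of degree `d`, top-indexed: for
`1 ≤ n ≤ d`, `s_n = -n c_{d-n} - Σ_{i+j=n, i,j ≥ 1} c_{d-i} s_j`. [folklore] -/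
theorem powerSum_frobRoots_newton {h : ℤ[X]} (hh : h.Monic) {n : ℕ} (hn1 : 1 ≤ n) (hn : n ≤ h.natDegree) :
    powerSum (frobRoots h) n = -((n : ℂ) * (h.coeff (h.natDegree - n) : ℂ)) -
      ∑ a ∈ (antidiagonal n).filter (fun a => 0 < a.1 ∧ 0 < a.2),
        (h.coeff (h.natDegree - a.1) : ℂ) * powerSum (frobRoots h) a.2 := by
  set d := h.natDegree with hd
  set A := frobRoots h with hA
  have hc : ∀ i, i ≤ d → (-1 : ℂ) ^ i * A.esymm i = (h.coeff (d - i) : ℂ) := by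
    intro i hi
    rw [cast_coeff_sub_eq_esymm hh hi]
  have key : (n : ℂ) * A.esymm n = (-1) ^ (n + 1) *
      ∑ a ∈ (antidiagonal n).filter (fun a => a.1 < n), (-1) ^ a.1 * A.esymm a.1 * powerSum A a.2 :=
    Literature.Analysis.Complex.SCV.natCast_mul_esymm_eq_sum A n
  have hsum : ∑ a ∈ (antidiagonal n).filter (fun a => a.1 < n), (-1 : ℂ) ^ a.1 * A.esymm a.1 * powerSum A a.2
      = powerSum A n + ∑ a ∈ (antidiagonal n).filter (fun a => 0 < a.1 ∧ 0 < a.2),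
          (h.coeff (d - a.1) : ℂ) * powerSum A a.2 := by
    have hmem : ((0 : ℕ), n) ∈ (antidiagonal n).filter (fun a => a.1 < n) := by
      simp only [mem_filter, HasAntidiagonal.mem_antidiagonal]; omega
    rw [← add_sum_erase _ _ hmem, pow_zero, one_mul, multiset_esymm_zero, one_mul]
    congr 1
    have hset : ((antidiagonal n).filter (fun a => a.1 < n)).erase (0, n)
        = (antidiagonal n).filter (fun a => 0 < a.1 ∧ 0 < a.2) := by
      ext a
      simp only [mem_erase, mem_filter, HasAntidiagonal.mem_antidiagonal, Ne, Prod.ext_iff]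
      omega
    rw [hset]
    refine sum_congr rfl fun a ha => ?_
    rw [mem_filter, HasAntidiagonal.mem_antidiagonal] at ha
    rw [hc a.1 (by omega)]
  set S := ∑ a ∈ (antidiagonal n).filter (fun a => 0 < a.1 ∧ 0 < a.2),
    (h.coeff (d - a.1) : ℂ) * powerSum A a.2 with hS
  have hen : A.esymm n = (-1 : ℂ) ^ n * (h.coeff (d - n) : ℂ) := by
    rw [← hc n hn, ← mul_assoc, ← pow_add, ← two_mul, pow_mul]
    norm_num
  have hσ : ((-1 : ℂ) ^ n) * ((-1 : ℂ) ^ n) = 1 := by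
    rw [← pow_add, ← two_mul, pow_mul]; norm_num
  rw [hsum, hen, pow_succ] at key
  linear_combination ((-1 : ℂ) ^ n) * key - ((n : ℂ) * (h.coeff (d - n) : ℂ) + powerSum A n + S) * hσ

/-- INTEGER NEWTON RECURSION: with `z_j ∈ ℤ` the power sums (`MotivicDoorFfLatticeFloor.exists_int_powerSum_frobRoots`),
`z_n = -n c_{d-n} - Σ_{i+j=n, i,j≥1} c_{d-i} z_j` in `ℤ` (`1 ≤ n ≤ d`). [folklore] -/
theorem int_powerSum_newton {h : ℤ[X]} (hh : h.Monic) {z : ℕ → ℤ}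
    (hz : ∀ n, powerSum (frobRoots h) n = (z n : ℂ)) {n : ℕ} (hn1 : 1 ≤ n) (hn : n ≤ h.natDegree) :
    z n = -((n : ℤ) * h.coeff (h.natDegree - n)) -
      ∑ a ∈ (antidiagonal n).filter (fun a => 0 < a.1 ∧ 0 < a.2),
        h.coeff (h.natDegree - a.1) * z a.2 := by
  have e := powerSum_frobRoots_newton hh hn1 hn
  simp only [hz] at e
  exact_mod_cast e

/-! ## 3. The sparse fibre walk: prescribing all of `s_1, …, s_g` but one

Honest data of dimension `g` (monic, degree `2g`, coefficient FE — typed INLINE as in parts 2–6) have the free top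
coefficients `c_{2g-k}`, `1 ≤ k ≤ g`; the FE-symmetric FIBRE SHIFT of part 5b (the same explicit sum, file-local
notation again) moves them one at a time. -/

local notation "fibreShift[" q ", " g ", " M ", " a "]" =>
  ((∑ k ∈ Finset.Ioo M g, C (a k) * (X ^ (2 * g - k) + C ((q : ℤ) ^ (g - k)) * X ^ k)) + C (a g) * X ^ g : ℤ[X])

/-- ONE MOVE: shifting the free coefficient `c_{2g-k}` (`1 ≤ k ≤ g`) of an honest datum by `δ` (FE-symmetrically)
gives an honest datum with the other free coefficients and the power sums `s_j`, `1 ≤ j < k`, unchanged. [folklore] -/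
theorem honest_shift_single {q g k : ℕ} (hk1 : 1 ≤ k) (hkg : k ≤ g) {f : ℤ[X]} (hf : f.Monic)
    (hdeg : f.natDegree = 2 * g)
    (hFE : ∀ i j, i + j = 2 * g → (q : ℤ) ^ g * f.coeff j = (q : ℤ) ^ i * f.coeff i) (δ : ℤ) :
    ∃ f' : ℤ[X], f'.Monic ∧ f'.natDegree = 2 * g ∧
      (∀ i j, i + j = 2 * g → (q : ℤ) ^ g * f'.coeff j = (q : ℤ) ^ i * f'.coeff i) ∧
      (∀ k', k' ≤ g → k' ≠ k → f'.coeff (2 * g - k') = f.coeff (2 * g - k')) ∧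
      f'.coeff (2 * g - k) = f.coeff (2 * g - k) + δ ∧
      ∀ j, 1 ≤ j → j < k → powerSum (frobRoots f') j = powerSum (frobRoots f) j := by
  have hM : (k - 1) + 1 ≤ g := by omega
  obtain ⟨hmon, hdeg', hFE', -, hread⟩ :=
    fibreShift_honest (q := q) (M := k - 1) hM hf hdeg hFE (fun i => if i = k then δ else 0)
  have hother : ∀ k', k' ≤ g → k' ≠ k →
      (f + fibreShift[q, g, k - 1, fun i => if i = k then δ else 0]).coeff (2 * g - k')
        = f.coeff (2 * g - k') := by
    intro k' hk' hk'k
    rcases lt_or_gt_of_ne hk'k with hlt | hgt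
    · rw [coeff_add, coeff_fibreShift_eq_zero q hM _ (by omega), add_zero]
    · rw [hread k' (by omega) hk', if_neg (by omega), add_zero]
  refine ⟨_, hmon, hdeg', hFE', hother, ?_, fun j hj1 hjk => ?_⟩
  · rw [hread k (by omega) hkg, if_pos rfl]
  · -- the power sums `s_j`, `j < k`, from the unchanged top coefficients (Vieta + Newton, part L1(ii))
    set f' := f + fibreShift[q, g, k - 1, fun i => if i = k then δ else 0] with hf'
    have hmon' : (f'.map (Int.castRingHom ℂ)).Monic := hmon.map _
    have hmonf : (f.map (Int.castRingHom ℂ)).Monic := hf.map _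
    have hd' : (f'.map (Int.castRingHom ℂ)).natDegree = 2 * g := by rw [hmon.natDegree_map, hdeg']
    have hdf : (f.map (Int.castRingHom ℂ)).natDegree = 2 * g := by rw [hf.natDegree_map, hdeg]
    have he := esymm_roots_eq_of_coeff_eq hmon' hmonf (hd'.trans hdf.symm) (m := k - 1)
      (fun k0 hk0 hk0M hk0d => by
        rw [hd', coeff_map, coeff_map, hother k0 (by omega) (by omega)])
    exact powerSum_eq_of_esymm_eq he j hj1 (by omega)

/-- THE SPARSE FIBRE WALK (induction on the depth `n`, `m ≤ n ≤ g`): for an honest datum `h` of dimension `g`, a lag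
`1 ≤ m ≤ g` and an integer `t`, there is an honest datum of dimension `g` whose free coefficient `c_{2g-m}` is moved
by `(g!)^g t`, whose power sums `s_j`, `1 ≤ j ≤ n`, `j ≠ m`, are those of `h`, whose `s_m` is moved by
`-m (g!)^g t`, and whose coefficient moves are divisible by `(g!)^{g-n}` (the room needed to clear the denominators
`j ≤ g` of the Newton recursion at the later lags). [folklore] -/
theorem sparseFibre_walk {q g m : ℕ} (hm1 : 1 ≤ m) (hmg : m ≤ g) {h : ℤ[X]} (hh : h.Monic)
    (hdeg : h.natDegree = 2 * g)
    (hFE : ∀ i j, i + j = 2 * g → (q : ℤ) ^ g * h.coeff j = (q : ℤ) ^ i * h.coeff i) (t : ℤ) :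
    ∀ n, m ≤ n → n ≤ g → ∃ f : ℤ[X], f.Monic ∧ f.natDegree = 2 * g ∧
      (∀ i j, i + j = 2 * g → (q : ℤ) ^ g * f.coeff j = (q : ℤ) ^ i * f.coeff i) ∧
      (∀ k, n < k → k ≤ g → f.coeff (2 * g - k) = h.coeff (2 * g - k)) ∧
      f.coeff (2 * g - m) = h.coeff (2 * g - m) + (g.factorial : ℤ) ^ g * t ∧
      (∀ j, 1 ≤ j → j ≤ n → j ≠ m → powerSum (frobRoots f) j = powerSum (frobRoots h) j) ∧
      powerSum (frobRoots f) m
        = powerSum (frobRoots h) m - (m : ℂ) * (((g.factorial : ℤ) ^ g * t : ℤ) : ℂ) ∧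
      (∀ k, k ≤ n → ((g.factorial : ℤ) ^ (g - n)) ∣ (f.coeff (2 * g - k) - h.coeff (2 * g - k))) := by
  set L : ℤ := (g.factorial : ℤ) ^ g with hL
  refine Nat.le_induction (fun _ => ?base) (fun n hmn IH hn1g => ?step)
  · -- BASE `n = m`: move `c_{2g-m}` by `L t`
    obtain ⟨f, hf, hdegf, hFEf, hother, hread, hps⟩ := honest_shift_single (q := q) hm1 hmg hh hdeg hFE (L * t)
    refine ⟨f, hf, hdegf, hFEf, fun k hk hkg => hother k hkg (by omega), hread,
      fun j hj1 hjm hjne => hps j hj1 (by omega), ?_, fun k hk => ?_⟩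
    · -- `s_m` moves by `-m L t`: Newton at lag `m` for `f` and for `h`
      rw [powerSum_frobRoots_newton hf hm1 (by rw [hdegf]; omega),
        powerSum_frobRoots_newton hh hm1 (by rw [hdeg]; omega), hdegf, hdeg, hread]
      have hS : ∑ a ∈ (antidiagonal m).filter (fun a => 0 < a.1 ∧ 0 < a.2),
            (f.coeff (2 * g - a.1) : ℂ) * powerSum (frobRoots f) a.2
          = ∑ a ∈ (antidiagonal m).filter (fun a => 0 < a.1 ∧ 0 < a.2),
            (h.coeff (2 * g - a.1) : ℂ) * powerSum (frobRoots h) a.2 := by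
        refine sum_congr rfl fun a ha => ?_
        rw [mem_filter, HasAntidiagonal.mem_antidiagonal] at ha
        rw [hother a.1 (by omega) (by omega), hps a.2 (by omega) (by omega)]
      rw [hS]
      push_cast
      ring
    · rcases (Nat.le_iff_lt_or_eq.1 hk) with hlt | rfl
      · rw [hother k (by omega) (by omega), sub_self]; exact dvd_zero _
      · rw [hread, add_sub_cancel_left]
        exact (pow_dvd_pow _ (Nat.sub_le g k)).mul_right t
  · -- STEP `n → n + 1` (`m ≤ n`, `n + 1 ≤ g`): move `c_{2g-(n+1)}` so that `s_{n+1}` is restored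
    obtain ⟨f, hf, hdegf, hFEf, hhi, hread, hps, hpm, hdvd⟩ := IH (by omega)
    obtain ⟨z, hz⟩ := exists_int_powerSum_frobRoots hh
    obtain ⟨z', hz'⟩ := exists_int_powerSum_frobRoots hf
    -- the defect of Newton's recursion at lag `n + 1`
    set I := (antidiagonal (n + 1)).filter (fun a => 0 < a.1 ∧ 0 < a.2) with hI
    set D : ℤ := ∑ a ∈ I, (h.coeff (2 * g - a.1) * z a.2 - f.coeff (2 * g - a.1) * z' a.2) with hD
    have hzdiff : ∀ j, 1 ≤ j → j ≤ n → ((g.factorial : ℤ) ^ (g - n)) ∣ (z' j - z j) := by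
      intro j hj1 hjn
      by_cases hjm : j = m
      · subst hjm
        have e : (z' j : ℂ) = (z j : ℂ) - (j : ℂ) * ((L * t : ℤ) : ℂ) := by rw [← hz', ← hz, hpm]
        have e' : z' j - z j = -(j * (L * t)) := by
          have : (z' j : ℂ) = ((z j - j * (L * t) : ℤ) : ℂ) := by rw [e]; push_cast; ring
          have := (Int.cast_injective (α := ℂ)) this
          linarith
        rw [e', hL]
        exact (((pow_dvd_pow _ (Nat.sub_le g n)).mul_right t).mul_left (j : ℤ)).neg_right
      · have e : (z' j : ℂ) = (z j : ℂ) := by rw [← hz', ← hz, hps j hj1 hjn hjm]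
        rw [Int.cast_injective (α := ℂ) e, sub_self]
        exact dvd_zero _
    have hDdvd : ((g.factorial : ℤ) ^ (g - n)) ∣ D := by
      refine dvd_sum fun a ha => ?_
      rw [hI, mem_filter, HasAntidiagonal.mem_antidiagonal] at ha
      have e : h.coeff (2 * g - a.1) * z a.2 - f.coeff (2 * g - a.1) * z' a.2
          = -((f.coeff (2 * g - a.1) - h.coeff (2 * g - a.1)) * z' a.2
              + h.coeff (2 * g - a.1) * (z' a.2 - z a.2)) := by ring
      rw [e]
      exact (((hdvd a.1 (by omega)).mul_right _).add ((hzdiff a.2 (by omega) (by omega)).mul_left _)).neg_right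
    obtain ⟨r, hr⟩ := hDdvd
    -- clear the denominator `n + 1 ≤ g` of Newton's recursion inside `(g!)^{g-n} = g! · (g!)^{g-(n+1)}`
    have hfac : (n + 1) ∣ g.factorial := Nat.dvd_factorial (Nat.succ_pos n) hn1g
    set δ : ℤ := ((g.factorial / (n + 1) : ℕ) : ℤ) * (g.factorial : ℤ) ^ (g - (n + 1)) * r with hδ
    have hkey : ((n : ℤ) + 1) * δ = D := by
      have e1 : ((n : ℤ) + 1) * ((g.factorial / (n + 1) : ℕ) : ℤ) = (g.factorial : ℤ) := by
        have := Nat.div_mul_cancel hfac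
        exact_mod_cast (by rw [mul_comm]; exact this)
      have e2 : (g.factorial : ℤ) * (g.factorial : ℤ) ^ (g - (n + 1)) = (g.factorial : ℤ) ^ (g - n) := by
        rw [← pow_succ', show g - (n + 1) + 1 = g - n by omega]
      rw [hr, hδ, ← mul_assoc, ← mul_assoc, e1, e2]
    obtain ⟨f', hf', hdegf', hFEf', hother, hread', hps'⟩ :=
      honest_shift_single (q := q) (k := n + 1) (by omega) hn1g hf hdegf hFEf δ
    refine ⟨f', hf', hdegf', hFEf', fun k hk hkg => ?_, ?_, fun j hj1 hjn hjm => ?_, ?_, fun k hk => ?_⟩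
    · rw [hother k hkg (by omega), hhi k (by omega) hkg]
    · rw [hother m hmg (by omega), hread]
    · rcases (Nat.le_iff_lt_or_eq.1 hjn) with hlt | rfl
      · rw [hps' j hj1 hlt, hps j hj1 (by omega) hjm]
      · -- THE RESTORED LAG `n + 1`: Newton at lag `n + 1` for `f'` and for `h`
        rw [powerSum_frobRoots_newton hf' hj1 (by rw [hdegf']; omega),
          powerSum_frobRoots_newton hh hj1 (by rw [hdeg]; omega), hdegf', hdeg, hread',
          hhi (n + 1) (Nat.lt_succ_self n) hn1g]
        have hS' : ∑ a ∈ I, (f'.coeff (2 * g - a.1) : ℂ) * powerSum (frobRoots f') a.2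
            = ∑ a ∈ I, (f.coeff (2 * g - a.1) : ℂ) * (z' a.2 : ℂ) := by
          refine sum_congr rfl fun a ha => ?_
          rw [hI, mem_filter, HasAntidiagonal.mem_antidiagonal] at ha
          rw [hother a.1 (by omega) (by omega), hps' a.2 (by omega) (by omega), hz']
        have hS : ∑ a ∈ I, (h.coeff (2 * g - a.1) : ℂ) * powerSum (frobRoots h) a.2
            = ∑ a ∈ I, (h.coeff (2 * g - a.1) : ℂ) * (z a.2 : ℂ) := by
          refine sum_congr rfl fun a ha => ?_
          rw [hz]
        rw [hS', hS]
        have hkeyC : ((n : ℂ) + 1) * (δ : ℂ)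
            = ∑ a ∈ I, ((h.coeff (2 * g - a.1) : ℂ) * (z a.2 : ℂ) - (f.coeff (2 * g - a.1) : ℂ) * (z' a.2 : ℂ)) := by
          have := congrArg (fun x : ℤ => (x : ℂ)) hkey
          simpa [hD] using this
        rw [sum_sub_distrib] at hkeyC
        push_cast
        linear_combination (-1 : ℂ) * hkeyC
    · rw [hps' m hm1 (by omega), hpm]
    · rcases (Nat.le_iff_lt_or_eq.1 hk) with hlt | rfl
      · rw [hother k (by omega) (by omega)]
        exact (pow_dvd_pow _ (by omega)).trans (hdvd k (by omega))
      · rw [hread', hhi (n + 1) (Nat.lt_succ_self n) hn1g, add_sub_cancel_left, hδ]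
        exact Dvd.intro_left (((g.factorial / (n + 1) : ℕ) : ℤ) * r) (by ring)

/-- THE SPARSE FIBRE IS INFINITE THROUGH EVERY HONEST DATUM: for `1 ≤ m ≤ g` and every integer `t` there is an honest
datum of dimension `g` with the same power sums `s_j` (equivalently point counts `N_j`, or corner entries `K(j)`)
as `h` for ALL `j ∈ [1, g] ∖ {m}`, with `s_m` moved by `-m (g!)^g t` and `c_{2g-m}` moved by `(g!)^g t`.  In words:
no `g - 1` of the first `g` point counts of an abelian-variety-type datum determine the remaining one, not even up
to finitely many possibilities. [folklore] -/
theorem exists_honest_offLag {q g m : ℕ} (hm1 : 1 ≤ m) (hmg : m ≤ g) {h : ℤ[X]} (hh : h.Monic)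
    (hdeg : h.natDegree = 2 * g)
    (hFE : ∀ i j, i + j = 2 * g → (q : ℤ) ^ g * h.coeff j = (q : ℤ) ^ i * h.coeff i) (t : ℤ) :
    ∃ f : ℤ[X], f.Monic ∧ f.natDegree = 2 * g ∧
      (∀ i j, i + j = 2 * g → (q : ℤ) ^ g * f.coeff j = (q : ℤ) ^ i * f.coeff i) ∧
      (∀ j, 1 ≤ j → j ≤ g → j ≠ m → powerSum (frobRoots f) j = powerSum (frobRoots h) j) ∧
      powerSum (frobRoots f) m
        = powerSum (frobRoots h) m - (m : ℂ) * (((g.factorial : ℤ) ^ g * t : ℤ) : ℂ) ∧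
      f.coeff (2 * g - m) = h.coeff (2 * g - m) + (g.factorial : ℤ) ^ g * t := by
  obtain ⟨f, hf, hdegf, hFEf, -, hread, hps, hpm, -⟩ := sparseFibre_walk hm1 hmg hh hdeg hFE t g hmg le_rfl
  exact ⟨f, hf, hdegf, hFEf, hps, hpm, hread⟩

/-- The SPARSE FIBRE `{f honest of dimension g : s_j(f) = s_j(h), j ∈ [1,g] ∖ {m}}` through an honest datum `h` is
INFINITE (`1 ≤ m ≤ g`; any `q`). [folklore] -/
theorem sparseFibre_infinite {q g m : ℕ} (hm1 : 1 ≤ m) (hmg : m ≤ g) {h : ℤ[X]} (hh : h.Monic)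
    (hdeg : h.natDegree = 2 * g)
    (hFE : ∀ i j, i + j = 2 * g → (q : ℤ) ^ g * h.coeff j = (q : ℤ) ^ i * h.coeff i) :
    {f : ℤ[X] | f.Monic ∧ f.natDegree = 2 * g ∧
      (∀ i j, i + j = 2 * g → (q : ℤ) ^ g * f.coeff j = (q : ℤ) ^ i * f.coeff i) ∧
      ∀ j, 1 ≤ j → j ≤ g → j ≠ m → powerSum (frobRoots f) j = powerSum (frobRoots h) j}.Infinite := by
  choose F hF using fun t : ℤ => exists_honest_offLag (q := q) hm1 hmg hh hdeg hFE t
  have hL : ((g.factorial : ℤ) ^ g) ≠ 0 := pow_ne_zero _ (by exact_mod_cast g.factorial_ne_zero)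
  refine Set.infinite_of_injective_forall_mem (f := F) (fun t₁ t₂ ht => ?_)
    (fun t => ⟨(hF t).1, (hF t).2.1, (hF t).2.2.1, (hF t).2.2.2.1⟩)
  have e : (F t₁).coeff (2 * g - m) = (F t₂).coeff (2 * g - m) := by rw [ht]
  rw [(hF t₁).2.2.2.2.2, (hF t₂).2.2.2.2.2, add_right_inj] at e
  exact mul_left_cancel₀ hL e

/-- … while its RH-true part is FINITE (Weil box, part 5a `setOf_ffRH_finite`) … [folklore] -/
theorem sparseFibre_ffRH_finite (q g m : ℕ) (h : ℤ[X]) :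
    {f : ℤ[X] | (f.Monic ∧ f.natDegree = 2 * g ∧
      (∀ i j, i + j = 2 * g → (q : ℤ) ^ g * f.coeff j = (q : ℤ) ^ i * f.coeff i) ∧
      ∀ j, 1 ≤ j → j ≤ g → j ≠ m → powerSum (frobRoots f) j = powerSum (frobRoots h) j) ∧
      ∀ α ∈ frobRoots f, ‖α‖ = Real.sqrt q}.Finite :=
  (setOf_ffRH_finite q g).subset fun _ hf => ⟨hf.1.1, hf.1.2.1, hf.2⟩

/-- … so the sparse fibre contains INFINITELY MANY honest RH-FALSE data (all but finitely many of its members):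
any `g - 1` of the power sums `s_1, …, s_g` of an honest datum are shared by infinitely many honest RH-false data of
the same dimension. [folklore] -/
theorem sparseFibre_fakes_infinite {q g m : ℕ} (hm1 : 1 ≤ m) (hmg : m ≤ g) {h : ℤ[X]} (hh : h.Monic)
    (hdeg : h.natDegree = 2 * g)
    (hFE : ∀ i j, i + j = 2 * g → (q : ℤ) ^ g * h.coeff j = (q : ℤ) ^ i * h.coeff i) :
    {f : ℤ[X] | f.Monic ∧ f.natDegree = 2 * g ∧
      (∀ i j, i + j = 2 * g → (q : ℤ) ^ g * f.coeff j = (q : ℤ) ^ i * f.coeff i) ∧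
      (∀ j, 1 ≤ j → j ≤ g → j ≠ m → powerSum (frobRoots f) j = powerSum (frobRoots h) j) ∧
      ¬ ∀ α ∈ frobRoots f, ‖α‖ = Real.sqrt q}.Infinite := by
  refine ((sparseFibre_infinite hm1 hmg hh hdeg hFE).sdiff (sparseFibre_ffRH_finite q g m h)).mono ?_
  rintro f ⟨hf, hfR⟩
  exact ⟨hf.1, hf.2.1, hf.2.2.1, hf.2.2.2, fun hR => hfR ⟨hf, hR⟩⟩

end Summit.RiemannHypothesis.RiemannHypothesis.Theorems.MotivicDoor.FunctionField

end
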